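import Mathlib.NumberTheory.NumberField.Units.DirichletTheorem
import Mathlib.RingTheory.DedekindDomain.AdicValuation
import Literature.FieldTheory.Kummer.KummerFiniteRank
import HarnessLib

/-!
# Fundamental units and generators of prime-power ideals are independent modulo `n`-th powers

Topic `NumberTheory/NumberFields`.  Theorem-only file (no definition, no named fact).

Let `K` be a number field, `ε₁, …, ε_r` Mathlib's fundamental system of units
(`NumberField.Units.fundSystem`), `𝔭₁, …, 𝔭_s` distinct nonzero primes of `𝓞 K` and `g_j` a
generator of the principal ideal `𝔭_j ^ h` (`h ≥ 1`, e.g. `h` = the class number).  For every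
`n ≥ 1` prime to `h` the family `(ε₁, …, ε_r, g₁, …, g_s)` is **independent modulo `n`-th powers**
in `K` in the sense of `Literature.FieldTheory.Kummer.IndepModPowers`: if `∏ εᵢ^{aᵢ} ∏ g_j^{b_j}`
(`aᵢ, b_j ∈ ℤ`) is an `n`-th power in `K` then `n ∣ aᵢ` and `n ∣ b_j`
(`indepModPowers_fundSystem_append`).  Proof: the `𝔭_j`-adic valuation gives `n ∣ h b_j`, so
`n ∣ b_j`; the remaining unit `∏ εᵢ^{aᵢ}` is then an `n`-th power of a unit, and the uniqueness
half of Dirichlet's unit theorem (`NumberField.Units.exist_unique_eq_mul_prod`) gives `n ∣ aᵢ`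
(`indepModPowers_fundSystem`).  This is the standard computation of the Kummer group
generated by units and `S`-units modulo `n`-th powers (Washington, *Cyclotomic Fields*, proof of
Thm. 15.2 / §15.2, "the map `E/E^q → K^×/K^{×q}` is injective"; Lang, *Algebra* VI §8).

Also: the reduction of `IndepModPowers` to exponent vectors in `{0, …, n-1}`
(`indepModPowers_of_forall_lt`).

## References

* L. C. Washington, *Introduction to Cyclotomic Fields*, 2nd ed., GTM 83, Springer 1997, §15.2.
  [Washington1997]
* S. Lang, *Algebra*, 3rd ed., GTM 211, Springer 2002, Ch. VI §8. [Lang2002]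
-/

namespace Literature.NumberTheory.NumberFields

open NumberField NumberField.Units IsDedekindDomain Literature.FieldTheory.Kummer

/-! ### Reduction to small natural exponents -/

section Reduction

variable {L : Type*} [Field L] {k : ℕ}

/-- To prove independence of nonzero `c₁, …, c_k` modulo `n`-th powers (`n ≥ 1`) it suffices to
treat exponent vectors `r` with `0 ≤ rᵢ < n` and show they vanish: write `vᵢ = n qᵢ + rᵢ` and
divide the `n`-th root by `∏ cᵢ^{qᵢ}`. [folklore] -/
theorem indepModPowers_of_forall_lt {n : ℕ} (hn : 0 < n) {c : Fin k → L} (hc : ∀ i, c i ≠ 0)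
    (H : ∀ r : Fin k → ℕ, (∀ i, r i < n) → (∃ x : L, x ^ n = ∏ i, c i ^ r i) → ∀ i, r i = 0) :
    IndepModPowers n c := by
  rintro v ⟨x, hx⟩ i
  have hn' : (0 : ℤ) < n := by exact_mod_cast hn
  set r : Fin k → ℕ := fun i => (v i % n).toNat with hr
  have hrv : ∀ i, ((r i : ℕ) : ℤ) = v i % n := fun i =>
    Int.toNat_of_nonneg (Int.emod_nonneg _ hn'.ne')
  have hv : ∀ i, v i = n * (v i / n) + r i := fun i => by
    rw [hrv, Int.mul_ediv_add_emod]
  have hrlt : ∀ i, r i < n := fun i => by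
    have h1 := Int.emod_lt_of_pos (v i) hn'
    have h2 := hrv i
    omega
  have hA : (∏ i, c i ^ (v i / n)) ≠ 0 :=
    Finset.prod_ne_zero_iff.mpr fun i _ => zpow_ne_zero _ (hc i)
  have hsplit : ∏ i, c i ^ v i = (∏ i, c i ^ (v i / n)) ^ n * ∏ i, c i ^ r i := by
    rw [← Finset.prod_pow, ← Finset.prod_mul_distrib]
    refine Finset.prod_congr rfl fun i _ => ?_
    calc c i ^ v i = c i ^ ((n : ℤ) * (v i / n) + r i) := by rw [← hv i]
      _ = (c i ^ (v i / n)) ^ n * c i ^ r i := by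
        rw [zpow_add₀ (hc i), mul_comm (n : ℤ), zpow_mul, zpow_natCast, zpow_natCast]
  have key : (x / ∏ i, c i ^ (v i / (n : ℤ))) ^ n = ∏ i, c i ^ r i := by
    rw [div_pow, div_eq_iff (pow_ne_zero _ hA), hx, hsplit, mul_comm]
  have h0 := H r hrlt ⟨_, key⟩ i
  rw [hv i, h0, Nat.cast_zero, add_zero]
  exact dvd_mul_right _ _

end Reduction

/-! ### Units -/

section Units

variable {K : Type*} [Field K] [NumberField K]

omit [NumberField K] in
/-- The coercion `(𝓞 K)ˣ → K` on a product of integer powers of units. [folklore] -/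
theorem coe_prod_zpow {ι : Type*} (s : Finset ι) (u : ι → (𝓞 K)ˣ) (v : ι → ℤ) :
    (((∏ i ∈ s, u i ^ v i : (𝓞 K)ˣ) : 𝓞 K) : K) = ∏ i ∈ s, (((u i : (𝓞 K)ˣ) : 𝓞 K) : K) ^ v i := by
  set φ : (𝓞 K)ˣ →* K := (algebraMap (𝓞 K) K).toMonoidHom.comp (Units.coeHom (𝓞 K)) with hφ
  change φ (∏ i ∈ s, u i ^ v i) = _
  rw [map_prod]
  exact Finset.prod_congr rfl fun i _ => coe_zpow (u i) (v i)

/-- **The fundamental units are independent modulo `n`-th powers in `K`** (`n ≥ 1`): if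
`∏ εᵢ^{vᵢ} = xⁿ` with `x ∈ K` then `x` is a unit of `𝓞 K` and, comparing Dirichlet coordinates
(uniqueness in `NumberField.Units.exist_unique_eq_mul_prod`), `vᵢ = n · eᵢ(x)`.  (Washington §15.2: the natural map
`E/Eⁿ → K^×/K^{×n}` is injective.) [cite: Washington1997, §15.2] -/
theorem indepModPowers_fundSystem {n : ℕ} (hn : 0 < n) :
    IndepModPowers n (fun i => (((fundSystem K i : (𝓞 K)ˣ) : 𝓞 K) : K)) := by
  rintro v ⟨x, hx⟩ i
  set U : (𝓞 K)ˣ := ∏ i, fundSystem K i ^ v i with hU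
  have hUK : (((U : (𝓞 K)ˣ) : 𝓞 K) : K) = ∏ i, (((fundSystem K i : (𝓞 K)ˣ) : 𝓞 K) : K) ^ v i :=
    coe_prod_zpow _ _ _
  have hxn : x ^ n = (((U : (𝓞 K)ˣ) : 𝓞 K) : K) := by rw [hx, hUK]
  have hint : IsIntegral ℤ x := by
    refine IsIntegral.of_pow hn ?_
    rw [hxn]
    exact RingOfIntegers.isIntegral_coe _
  set y : 𝓞 K := ⟨x, hint⟩ with hy
  have hyx : ((y : 𝓞 K) : K) = x := rfl
  have hyn : y ^ n = (U : 𝓞 K) := by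
    apply RingOfIntegers.coe_injective
    rw [map_pow]
    exact hxn
  have hyu : IsUnit y := (isUnit_pow_iff hn.ne').mp (hyn ▸ Units.isUnit U)
  obtain ⟨w, hw⟩ := hyu
  have hwn : w ^ n = U := Units.ext (by rw [Units.val_pow_eq_pow_val, hw, hyn])
  obtain ⟨⟨ζ, e⟩, hwe, -⟩ := exist_unique_eq_mul_prod K w
  have hU1 : U = ((1 : torsion K) : (𝓞 K)ˣ) * ∏ i, fundSystem K i ^ v i := by
    rw [OneMemClass.coe_one, one_mul]
  have hU2 : U = ((ζ ^ n : torsion K) : (𝓞 K)ˣ) * ∏ i, fundSystem K i ^ ((n : ℤ) * e i) := by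
    rw [← hwn, hwe, mul_pow, ← Finset.prod_pow, SubmonoidClass.coe_pow]
    congr 1
    refine Finset.prod_congr rfl fun i _ => ?_
    rw [← zpow_natCast, ← zpow_mul, mul_comm]
  have h3 := (exist_unique_eq_mul_prod K U).unique (y₁ := (1, v)) (y₂ := (ζ ^ n, fun i => (n : ℤ) * e i))
    hU1 hU2
  rw [Prod.mk.injEq] at h3
  exact ⟨e i, congrFun h3.2 i⟩

end Units

/-! ### Units and generators of prime powers -/

section Append

variable {K : Type*} [Field K] [NumberField K]

omit [NumberField K] in
/-- A generator of `𝔭 ^ h` is nonzero. [folklore] -/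
theorem ne_zero_of_span_singleton_eq_pow {h : ℕ} {𝔭 : HeightOneSpectrum (𝓞 K)} {g : 𝓞 K}
    (hg : Ideal.span {g} = 𝔭.asIdeal ^ h) : g ≠ 0 := by
  intro h0
  rw [h0, Ideal.span_singleton_zero, eq_comm] at hg
  exact pow_ne_zero h 𝔭.ne_bot hg

/-- The members of the family `(ε₁, …, ε_r, g₁, …, g_s)` are nonzero. [folklore] -/
theorem fundSystem_append_ne_zero {h s : ℕ} {𝔭 : Fin s → HeightOneSpectrum (𝓞 K)}
    {g : Fin s → 𝓞 K} (hg : ∀ j, Ideal.span {g j} = (𝔭 j).asIdeal ^ h) (i : Fin (rank K + s)) :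
    Fin.append (fun i => ((fundSystem K i : (𝓞 K)ˣ) : 𝓞 K)) g i ≠ 0 := by
  refine Fin.addCases (fun i => ?_) (fun j => ?_) i
  · rw [Fin.append_left]
    exact Units.ne_zero _
  · rw [Fin.append_right]
    exact ne_zero_of_span_singleton_eq_pow (hg j)

/-- The `𝔭_{j₀}`-adic valuation of `g_j` (a generator of `𝔭_j ^ h`, the `𝔭_j` distinct) is
`exp (-h)` if `j = j₀` and `1` otherwise. [folklore] -/
theorem intValuation_gen_eq {h s : ℕ} {𝔭 : Fin s → HeightOneSpectrum (𝓞 K)}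
    (h𝔭 : Function.Injective 𝔭) {g : Fin s → 𝓞 K}
    (hg : ∀ j, Ideal.span {g j} = (𝔭 j).asIdeal ^ h) (j₀ j : Fin s) :
    (𝔭 j₀).intValuation (g j) = WithZero.exp (-(if j = j₀ then (h : ℤ) else 0)) := by
  classical
  have hirr : ∀ v : HeightOneSpectrum (𝓞 K), Irreducible (Associates.mk v.asIdeal) := fun v =>
    Associates.irreducible_mk.mpr v.irreducible
  rw [(𝔭 j₀).intValuation_if_neg (ne_zero_of_span_singleton_eq_pow (hg j)), hg j, Associates.mk_pow,
    Associates.count_pow (Associates.mk_ne_zero.mpr (𝔭 j).ne_bot) (hirr _)]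
  by_cases hj : j = j₀
  · subst hj
    rw [Associates.count_self (hirr _), mul_one, if_pos rfl]
  · rw [Associates.count_eq_zero_of_ne (hirr _) (hirr _) ?_, mul_zero, if_neg hj, Nat.cast_zero]
    intro heq
    apply hj
    apply h𝔭
    have := associated_iff_eq.mp (Associates.mk_eq_mk_iff_associated.mp heq)
    exact (HeightOneSpectrum.ext this).symm

/-- **Units and generators of prime powers are independent modulo `n`-th powers.**  Let
`ε₁, …, ε_r` be the fundamental units, `𝔭₁, …, 𝔭_s` distinct primes of `𝓞 K`, `(g_j) = 𝔭_j ^ h`,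
and `n ≥ 1` prime to `h`.  If `∏ εᵢ^{aᵢ} · ∏ g_j^{b_j}` is an `n`-th power in `K` then `n` divides
every `aᵢ` and every `b_j`: the `𝔭_j`-adic valuation gives `n ∣ h b_j`, and the unit part is
handled by `indepModPowers_fundSystem`.  (Washington §15.2, the Kummer group generated by units
and the `𝔩`-units in the proof of Thaine's theorem.) [cite: Washington1997, §15.2] -/
theorem indepModPowers_fundSystem_append {n : ℕ} (hn : 0 < n) {h : ℕ} (hnh : n.Coprime h)
    {s : ℕ} {𝔭 : Fin s → HeightOneSpectrum (𝓞 K)} (h𝔭 : Function.Injective 𝔭)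
    {g : Fin s → 𝓞 K} (hg : ∀ j, Ideal.span {g j} = (𝔭 j).asIdeal ^ h) :
    IndepModPowers n (fun i =>
      ((Fin.append (fun i => ((fundSystem K i : (𝓞 K)ˣ) : 𝓞 K)) g i : 𝓞 K) : K)) := by
  classical
  set b : Fin (rank K + s) → 𝓞 K := Fin.append (fun i => ((fundSystem K i : (𝓞 K)ˣ) : 𝓞 K)) g
    with hb
  have hb0 : ∀ i, b i ≠ 0 := fundSystem_append_ne_zero hg
  have hg0 : ∀ j, g j ≠ 0 := fun j => ne_zero_of_span_singleton_eq_pow (hg j)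
  refine indepModPowers_of_forall_lt hn (fun i => RingOfIntegers.coe_ne_zero_iff.mpr (hb0 i)) ?_
  rintro r hr ⟨x, hx⟩
  -- `x` is an algebraic integer
  have hprod : (∏ i, (b i : K) ^ r i) = algebraMap (𝓞 K) K (∏ i, b i ^ r i) := by
    rw [map_prod]
    simp only [map_pow]
  have hint : IsIntegral ℤ x := by
    refine IsIntegral.of_pow hn ?_
    rw [hx, hprod]
    exact RingOfIntegers.isIntegral_coe _
  set y : 𝓞 K := ⟨x, hint⟩ with hy
  have hyx : algebraMap (𝓞 K) K y = x := rfl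
  have hyn : y ^ n = (∏ i : Fin (rank K), ((fundSystem K i : (𝓞 K)ˣ) : 𝓞 K) ^ r (Fin.castAdd s i)) *
      ∏ j, g j ^ r (Fin.natAdd (rank K) j) := by
    apply RingOfIntegers.coe_injective
    rw [map_pow, hyx, hx, hprod]
    congr 1
    rw [Fin.prod_univ_add]
    simp only [hb, Fin.append_left, Fin.append_right]
  -- Step A: the exponents of the `g_j` are divisible by `n`
  have hA : ∀ j₀ : Fin s, n ∣ r (Fin.natAdd (rank K) j₀) := by
    intro j₀
    have hwu : ∀ i : Fin (rank K),
        (𝔭 j₀).intValuation ((fundSystem K i : (𝓞 K)ˣ) : 𝓞 K) = 1 := fun i =>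
      HeightOneSpectrum.intValuation_eq_one_iff.mpr fun hmem =>
        (𝔭 j₀).isPrime.ne_top (Ideal.eq_top_of_isUnit_mem _ hmem (Units.isUnit _))
    have h1 := congrArg (𝔭 j₀).intValuation hyn
    simp only [map_pow, map_mul, map_prod, hwu, one_pow, Finset.prod_const_one, one_mul,
      intValuation_gen_eq h𝔭 hg j₀] at h1
    rw [Finset.prod_eq_single j₀ (fun j _ hj => by
      rw [if_neg hj, neg_zero, WithZero.exp_zero, one_pow]) (fun h' => absurd (Finset.mem_univ _) h'),
      if_pos rfl] at h1
    have hy0 : (𝔭 j₀).intValuation y ≠ 0 := by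
      intro h0
      rw [h0, zero_pow hn.ne'] at h1
      exact (pow_ne_zero _ WithZero.exp_ne_zero) h1.symm
    obtain ⟨a, ha⟩ : ∃ a : ℤ, (𝔭 j₀).intValuation y = WithZero.exp a :=
      ⟨WithZero.log ((𝔭 j₀).intValuation y), (WithZero.exp_log hy0).symm⟩
    rw [ha, ← WithZero.exp_nsmul, ← WithZero.exp_nsmul, WithZero.exp_inj, smul_neg, nsmul_eq_mul,
      nsmul_eq_mul] at h1
    have hdvd : (n : ℤ) ∣ ((r (Fin.natAdd (rank K) j₀) * h : ℕ) : ℤ) :=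
      ⟨-a, by push_cast; linarith⟩
    exact hnh.dvd_of_dvd_mul_right (Int.natCast_dvd_natCast.mp hdvd)
  -- Step B: the unit part
  choose t ht using hA
  set D : 𝓞 K := ∏ j, g j ^ t j with hD
  have hD0 : D ≠ 0 := Finset.prod_ne_zero_iff.mpr fun j _ => pow_ne_zero _ (hg0 j)
  have hDn : ∏ j, g j ^ r (Fin.natAdd (rank K) j) = D ^ n := by
    rw [hD, ← Finset.prod_pow]
    exact Finset.prod_congr rfl fun j _ => by rw [ht j, pow_mul, pow_right_comm]
  have hDK : ((D : 𝓞 K) : K) ≠ 0 := RingOfIntegers.coe_ne_zero_iff.mpr hD0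
  have hB : ∀ i : Fin (rank K), n ∣ r (Fin.castAdd s i) := by
    have h2 : algebraMap (𝓞 K) K (y ^ n) = algebraMap (𝓞 K) K
        ((∏ i : Fin (rank K), ((fundSystem K i : (𝓞 K)ˣ) : 𝓞 K) ^ r (Fin.castAdd s i)) * D ^ n) := by
      rw [hyn, hDn]
    simp only [map_pow, map_mul, map_prod] at h2
    have key : (x / (D : K)) ^ n =
        ∏ i, (((fundSystem K i : (𝓞 K)ˣ) : 𝓞 K) : K) ^ ((r (Fin.castAdd s i) : ℕ) : ℤ) := by
      simp only [zpow_natCast]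
      rw [div_pow, div_eq_iff (pow_ne_zero _ hDK)]
      exact h2
    intro i
    exact Int.natCast_dvd_natCast.mp (indepModPowers_fundSystem hn _ ⟨_, key⟩ i)
  -- conclusion
  intro i
  refine Fin.addCases (fun i => ?_) (fun j => ?_) i
  · exact Nat.eq_zero_of_dvd_of_lt (hB i) (hr _)
  · exact Nat.eq_zero_of_dvd_of_lt ⟨t j, ht j⟩ (hr _)

end Append

end Literature.NumberTheory.NumberFields
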